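import Summits.CriticalPhenomena.CardyFormulaZ2.Theorems.CardyIKTransportIKLinearTransportStubPinnedSamplerRowCFTPFinal

/-!
# Stub `stub_RowCFTP` (A_dyn) — part S: VERTICAL SHIFTS OF THE PINNED STATISTIC
# (the strip diagram is shift-covariant; the shift on the environment space)

Support file (`--supports stmt-CriticalPhenomena-5076`, registered sub-goal `pinnedStat_vshift`). The row
dynamics `Φ y p u z` of `IsRowCFTP` reads an ENVIRONMENT PARAMETER `p : Obs × Set (Site 2 × Site 2)` (a value
of `pinnedStat i = (eraseMid i, stripDiagram i)`) and must be vertically covariant SURELY (field `cov`):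
`Φ y (pinnedStat i (vshift k x)) (ushift k u) (vshift k z) = vshift k (Φ (y - k) (pinnedStat i x) u z)`. A
covariant `Φ` is obtained from its row-`0` map by conjugation with shifts once the shift acts on the
environment space itself: `pshift m (e, Δ) = (vshift m e, dshift m Δ)` with
`dshift m Δ = {pq | (pq.1 - (0,m), pq.2 - (0,m)) ∈ Δ}`, and (registered) `pinnedStat i (vshift m x) =
pshift m (pinnedStat i x)` — the strip diagram of the shifted configuration is the shifted strip diagram
(`stripDiagram_vshift`: the random triangulation `cellGraph` is translation-covariant, `cellGraph_adj_vshift`,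
and monochromatic strip paths translate, through the vertex-list form `ps_mem_stripDiagram_iff`, p94837).
Also: the group law of `pshift`, its measurability, and two integer-vector identities used downstream
(`…StubRowCFTPDynamics.lean`).
-/

noncomputable section

namespace Summit.CriticalPhenomena.CardyFormulaZ2.Theorems.IKLinearTransport.PinnedDiagramExchange

open scoped Classical MeasureTheory ENNReal symmDiff
open Set MeasureTheory
open Literature.Probability.Percolation Literature.Probability.LatticeModels

/-! ## Integer-vector identities -/

/-- Translating back: `(a, b + m) - (0, m) = (a, b)`. [folklore] -/
theorem ps3_vec_sub (a b m : ℤ) : (![a, b + m] : Site 2) - ![0, m] = ![a, b] := by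
  ext j; fin_cases j <;> simp

/-- `w - (0, m) = (a, b)` iff `w = (a, b + m)`. [folklore] -/
theorem ps3_sub_eq_vec_iff (w : Site 2) (a b m : ℤ) : w - ![0, m] = ![a, b] ↔ w = ![a, b + m] := by
  constructor
  · intro h
    have h' : w = ![a, b] + ![0, m] := eq_add_of_sub_eq h
    rw [h']; ext j; fin_cases j <;> simp
  · rintro rfl; exact ps3_vec_sub a b m

/-- Double translation. [folklore] -/
theorem ps3_sub_sub_vec (w : Site 2) (m k : ℤ) : w - ![0, m] - ![0, k] = w - ![0, m + k] := by
  ext j; fin_cases j <;> simp [sub_sub] <;> rfl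

/-! ## The shift on the environment space -/

/-- Vertical shift of a strip diagram (a set of pairs of boundary cells). [folklore] -/
def dshift (m : ℤ) (Δ : Set (Site 2 × Site 2)) : Set (Site 2 × Site 2) :=
  {pq | (pq.1 - ![0, m], pq.2 - ![0, m]) ∈ Δ}

/-- Vertical shift of an environment `p = (off-middle observables, strip diagram)`. [folklore] -/
def pshift (m : ℤ) (p : Obs × Set (Site 2 × Site 2)) : Obs × Set (Site 2 × Site 2) :=
  (vshift m p.1, dshift m p.2)

/-- `dshift` composes additively. [folklore] -/
theorem dshift_dshift (m k : ℤ) (Δ : Set (Site 2 × Site 2)) : dshift m (dshift k Δ) = dshift (m + k) Δ := by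
  ext pq; simp only [dshift, mem_setOf_eq, ps3_sub_sub_vec]

/-- `pshift` composes additively. [folklore] -/
theorem pshift_pshift (m k : ℤ) (p : Obs × Set (Site 2 × Site 2)) : pshift m (pshift k p) = pshift (m + k) p :=
  Prod.ext (ps_vshift_vshift m k p.1) (dshift_dshift m k p.2)

/-- The zero shift of an environment is the identity. [folklore] -/
theorem pshift_zero (p : Obs × Set (Site 2 × Site 2)) : pshift 0 p = p := by
  refine Prod.ext (ps_vshift_zero p.1) ?_
  ext pq
  have h1 : pq.1 - ![0, 0] = pq.1 := by ext j; fin_cases j <;> simp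
  have h2 : pq.2 - ![0, 0] = pq.2 := by ext j; fin_cases j <;> simp
  simp only [pshift, dshift, mem_setOf_eq, h1, h2, Prod.mk.eta]

/-- `dshift` is measurable. [folklore] -/
theorem measurable_dshift (m : ℤ) : Measurable (dshift m) :=
  measurable_set_iff.2 fun _ => measurable_set_mem _

/-- `pshift` is measurable. [folklore] -/
theorem measurable_pshift (m : ℤ) : Measurable (pshift m) :=
  ((measurable_vshift m).comp measurable_fst).prodMk ((measurable_dshift m).comp measurable_snd)

/-! ## The random triangulation and the strip diagram are translation-covariant -/

/-- Adjacency in the triangulation read from a shifted anti-diagonal set is shifted adjacency. [folklore] -/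
theorem cellGraph_adj_vshift (m : ℤ) (A : Set (Site 2)) (u v : Site 2) :
    (cellGraph ((fun w => w - ![0, m]) ⁻¹' A)).Adj u v ↔ (cellGraph A).Adj (u - ![0, m]) (v - ![0, m]) := by
  simp only [cellGraph, SimpleGraph.fromRel_adj, Set.mem_preimage, ne_eq, sub_left_inj, sub_add_eq_add_sub]

/-- One direction of the covariance of the strip diagram: a pair in the diagram of the shifted configuration,
translated back, is in the diagram. [folklore] -/
theorem mem_stripDiagram_vshift_imp (i m : ℤ) (x : Obs) (pq : Site 2 × Site 2)
    (h : pq ∈ stripDiagram i (vshift m x)) : (pq.1 - ![0, m], pq.2 - ![0, m]) ∈ stripDiagram i x := by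
  rw [ps_mem_stripDiagram_iff] at h ⊢
  obtain ⟨h1, h2, ⟨hcol, h3⟩, h4, l, hchain, hlast, hmem⟩ := h
  have e0 : ∀ w : Site 2, (w - ![0, m]) 0 = w 0 := fun w => (ps2_sub_vec_apply w m).1
  refine ⟨?_, ?_, ⟨hcol, ?_⟩, ?_, l.map (fun w => w - ![0, m]), ?_, ?_, ?_⟩
  · simp only [e0]; exact h1
  · simp only [e0]; exact h2
  · simp only [e0]; exact h3
  · simp only [e0]; exact h4
  · have hc : List.IsChain (cellGraph x.2).Adj ((pq.1 :: l).map fun w => w - ![0, m]) := by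
      rw [List.isChain_map]
      refine List.IsChain.imp (fun a b hab => ?_) hchain
      exact (cellGraph_adj_vshift m x.2 a b).1 hab
    simpa only [List.map_cons] using hc
  · have key : ∀ (L : List (Site 2)) (hL : L ≠ []) (hL' : L.map (fun w => w - ![0, m]) ≠ []),
        (L.map fun w => w - ![0, m]).getLast hL' = L.getLast hL - ![0, m] := fun L hL hL' =>
      List.getLast_map hL'
    have := key (pq.1 :: l) (List.cons_ne_nil _ _) (by simp)
    simp only [List.map_cons] at this
    rw [this, hlast]
  · intro w hw
    obtain ⟨a, ha, rfl⟩ := List.mem_map.1 hw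
    obtain ⟨hca, hia⟩ := hmem a ha
    exact ⟨hca, by rw [e0]; exact hia⟩

/-- THE STRIP DIAGRAM IS SHIFT-COVARIANT. [folklore] -/
theorem stripDiagram_vshift (i m : ℤ) (x : Obs) : stripDiagram i (vshift m x) = dshift m (stripDiagram i x) := by
  ext pq
  constructor
  · exact mem_stripDiagram_vshift_imp i m x pq
  · intro h
    have h' : (pq.1 - ![0, m], pq.2 - ![0, m]) ∈ stripDiagram i (vshift (-m) (vshift m x)) := by
      rw [ps_vshift_vshift, neg_add_cancel, ps_vshift_zero]; exact h
    have := mem_stripDiagram_vshift_imp i (-m) (vshift m x) _ h'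
    simp only [ps3_sub_sub_vec, add_neg_cancel] at this
    have e : ∀ w : Site 2, w - ![0, (0 : ℤ)] = w := fun w => by ext j; fin_cases j <;> simp
    simpa only [e, Prod.mk.eta] using this

/-- THE PINNED STATISTIC IS SHIFT-COVARIANT (registered sub-goal): the off-middle observables and the strip
diagram of the shifted configuration are the shifted ones. [folklore] -/
theorem pinnedStat_vshift : ∀ (i m : ℤ) (x : Obs), pinnedStat i (vshift m x) =
    (vshift m (pinnedStat i x).1, {pq | (pq.1 - ![0, m], pq.2 - ![0, m]) ∈ (pinnedStat i x).2}) :=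
  fun i m x => Prod.ext (ps2_eraseMid_vshift i m x) (stripDiagram_vshift i m x)

/-- The pinned statistic is shift-covariant, through `pshift`. [folklore] -/
theorem pinnedStat_vshift' (i m : ℤ) (x : Obs) : pinnedStat i (vshift m x) = pshift m (pinnedStat i x) :=
  pinnedStat_vshift i m x

/-! ## Shifting the product space preserves `νmix S ⊗ β` -/

/-- The product shift `(vshift m, ushift m)` preserves `νmix S ⊗ β`. [folklore] -/
theorem prod_map_shift (S : Set ℤ) (m : ℤ) :
    ((νmix S).prod β).map (Prod.map (vshift m) (ushift m)) = (νmix S).prod β := by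
  haveI : IsProbabilityMeasure β := by
    rw [show β = sitePercolation (Site 2 × ℕ) half from rfl]; infer_instance
  haveI := isProbabilityMeasure_nuMix S
  rw [← Measure.map_prod_map _ _ (measurable_vshift m) (measurable_ushift m), nuMix_map_vshift,
    beta_map_ushift]

end Summit.CriticalPhenomena.CardyFormulaZ2.Theorems.IKLinearTransport.PinnedDiagramExchange
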